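import Mathlib
import Summits.MatrixMultiplication.MatrixMultiplication.Theorems.SoloBlindFibreCap

/-!
# Solo-blind seat (MatrixMultiplication), s79 — squarefree `L(3)`: a zero-sum-free SET in a group of
# exponent 3 has at most six 3-subsets with any prescribed sum, and six occurs
(HOME `paper/KraftK3.md` §7.22, K3.22.2; CLAIMS c845)

Background (door I1⁗, the Kraft conjecture `(K₃)` for zero-sum-free sequences over `𝔽₃`, and its layer
conjectures `L(k)`: a zero-sum-free sequence has at most `2^k` index sets of size `k` with a common sum;
`L(3)`, `L(4)` are census theorems of the seat).  This file proves BY HAND, in all ranks, the sharp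
SQUAREFREE case of `L(3)`:

* `soloBlind_rep3_card_le_six` — if `S` is a finite subset of an abelian group of exponent 3
  (`y + y + y = 0`) with no non-empty zero-sum subset, then for every `τ` at most SIX 3-element subsets
  of `S` have sum `τ` (for sequences with repeated terms the maximum is `8 = 2^3`, attained only with twins);
* `soloBlind_rep3_card_le_six_module` — the same for `ZMod 3`-modules;
* `soloBlind_rep3_six_attained` — an explicit zero-sum-free 10-set in `𝔽₃⁵` with exactly six 3-subsets
  of sum `τ = (2,1,2,0,2)`, so the constant 6 is optimal.

Proof (the members of `F = soloBlindRep3 S τ` form a linear 3-graph of a very special kind):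
(i) two distinct members share at most one element (`soloBlind_rep3_inter_card_le_one`);
(ii) no element lies in three members — the three complementary pairs would be disjoint with total
  `3(τ - x) = 0` (`soloBlind_rep3_three_point`);
(iii) no three members are pairwise disjoint — total `3τ = 0` (`soloBlind_rep3_three_disjoint`);
(iv) no four members meet pairwise — by (i),(ii) they would form a Pasch configuration
  `{ab,ac,ad}, {ab,bc,bd}, {ac,bc,cd}, {ad,bd,cd}`, and `ΣA + ΣB - ΣC - ΣD = 2(ab - cd) = 0` forces `ab = cd`
  (`soloBlind_rep3_no_four_meeting`);
(v) hence every member meets at most 3 others (one through each of its points) and misses at most 3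
  others (those are pairwise meeting), so `|F| ≤ 7`, and `|F| = 7` would make every member meet exactly 3
  others: `7·3 = 21` ordered meeting pairs — an odd number of elements for a fixed-point-free involution.
No `sorry`, standard axioms; the example is checked by `decide +kernel`.
-/

set_option autoImplicit false

namespace Summit.MatrixMultiplication.MatrixMultiplication.Theorems

open Finset

variable {G : Type*} [AddCommGroup G] [DecidableEq G]

/-- The 3-element subsets of `S` with sum `τ`. -/
def soloBlindRep3 (S : Finset G) (τ : G) : Finset (Finset G) :=
  (S.powersetCard 3).filter (fun T => ∑ x ∈ T, x = τ)

/-- Membership in `soloBlindRep3 S τ`: a subset of `S` of size 3 with sum `τ`. -/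
theorem soloBlind_mem_rep3 {S : Finset G} {τ : G} {A : Finset G} :
    A ∈ soloBlindRep3 S τ ↔ A ⊆ S ∧ A.card = 3 ∧ ∑ x ∈ A, x = τ := by
  simp only [soloBlindRep3, mem_filter, mem_powersetCard, and_assoc]

section Main

variable {S : Finset G} {τ : G}

/-- (i) Linearity: two distinct 3-representations of `τ` share at most one element. -/
theorem soloBlind_rep3_inter_card_le_one {A B : Finset G}
    (hA : A ∈ soloBlindRep3 S τ) (hB : B ∈ soloBlindRep3 S τ) (hne : A ≠ B) :
    (A ∩ B).card ≤ 1 := by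
  rw [soloBlind_mem_rep3] at hA hB
  obtain ⟨-, cA, sA⟩ := hA
  obtain ⟨-, cB, sB⟩ := hB
  by_contra hlt
  rw [not_le] at hlt
  have eA : ∑ x ∈ A \ (A ∩ B), x + ∑ x ∈ A ∩ B, x = τ := by
    rw [sum_sdiff inter_subset_left]; exact sA
  have eB : ∑ x ∈ B \ (A ∩ B), x + ∑ x ∈ A ∩ B, x = τ := by
    rw [sum_sdiff inter_subset_right]; exact sB
  have cIA : (A ∩ B).card ≤ 3 := cA ▸ card_le_card inter_subset_left
  have cdA : (A \ (A ∩ B)).card = 3 - (A ∩ B).card := by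
    rw [card_sdiff_of_subset inter_subset_left, cA]
  have cdB : (B \ (A ∩ B)).card = 3 - (A ∩ B).card := by
    rw [card_sdiff_of_subset inter_subset_right, cB]
  rcases Nat.lt_or_ge (A ∩ B).card 3 with h2 | h3
  · -- `|A ∩ B| = 2`: the two private elements are equal, absurd
    have h2' : (A ∩ B).card = 2 := by omega
    rw [h2'] at cdA cdB
    obtain ⟨a, ha⟩ := card_eq_one.mp cdA
    obtain ⟨b, hb⟩ := card_eq_one.mp cdB
    rw [ha, sum_singleton] at eA
    rw [hb, sum_singleton] at eB
    have hab : a = b := add_right_cancel (eA.trans eB.symm)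
    have haA : a ∈ A \ (A ∩ B) := by rw [ha]; exact mem_singleton_self a
    have hbB : b ∈ B \ (A ∩ B) := by rw [hb]; exact mem_singleton_self b
    rw [mem_sdiff] at haA hbB
    apply haA.2
    rw [mem_inter]
    refine ⟨haA.1, ?_⟩
    rw [hab]; exact hbB.1
  · -- `|A ∩ B| = 3`: `A = B`
    have e1 : A ∩ B = A := eq_of_subset_of_card_le inter_subset_left (by omega)
    have e2 : A ∩ B = B := eq_of_subset_of_card_le inter_subset_right (by omega)
    exact hne (e1.symm.trans e2)

/-- (ii) Point degree at most two: no element lies in three distinct 3-representations of `τ`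
(exponent 3 and zero-sum-freeness). -/
theorem soloBlind_rep3_three_point (zsf : ∀ T ⊆ S, ∑ x ∈ T, x = 0 → T = ∅)
    (h3 : ∀ y : G, y + y + y = 0) {A B C : Finset G} {x : G}
    (hA : A ∈ soloBlindRep3 S τ) (hB : B ∈ soloBlindRep3 S τ) (hC : C ∈ soloBlindRep3 S τ)
    (hAB : A ≠ B) (hAC : A ≠ C) (hBC : B ≠ C) (xA : x ∈ A) (xB : x ∈ B) (xC : x ∈ C) : False := by
  have iAB := soloBlind_rep3_inter_card_le_one hA hB hAB
  have iAC := soloBlind_rep3_inter_card_le_one hA hC hAC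
  have iBC := soloBlind_rep3_inter_card_le_one hB hC hBC
  rw [soloBlind_mem_rep3] at hA hB hC
  obtain ⟨sA, cA, eA⟩ := hA
  obtain ⟨sB, -, eB⟩ := hB
  obtain ⟨sC, -, eC⟩ := hC
  have key : ∀ {P Q : Finset G}, (P ∩ Q).card ≤ 1 → x ∈ P → x ∈ Q →
      Disjoint (P.erase x) (Q.erase x) := by
    intro P Q hPQ xP xQ
    rw [disjoint_left]
    intro y yP yQ
    rw [mem_erase] at yP yQ
    have : 1 < (P ∩ Q).card :=
      one_lt_card.mpr ⟨x, mem_inter.mpr ⟨xP, xQ⟩, y, mem_inter.mpr ⟨yP.2, yQ.2⟩,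
        fun h => yP.1 h.symm⟩
    omega
  have dAB := key iAB xA xB
  have dAC := key iAC xA xC
  have dBC := key iBC xB xC
  have sumA : ∑ y ∈ A.erase x, y = τ - x := by rw [sum_erase_eq_sub xA, eA]
  have sumB : ∑ y ∈ B.erase x, y = τ - x := by rw [sum_erase_eq_sub xB, eB]
  have sumC : ∑ y ∈ C.erase x, y = τ - x := by rw [sum_erase_eq_sub xC, eC]
  have hUS : A.erase x ∪ B.erase x ∪ C.erase x ⊆ S :=
    union_subset (union_subset ((erase_subset x A).trans sA) ((erase_subset x B).trans sB))
      ((erase_subset x C).trans sC)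
  have hsum : ∑ y ∈ A.erase x ∪ B.erase x ∪ C.erase x, y = 0 := by
    rw [sum_union (disjoint_union_left.mpr ⟨dAC, dBC⟩), sum_union dAB, sumA, sumB, sumC]
    exact h3 (τ - x)
  have hUe := zsf _ hUS hsum
  have c2 : (A.erase x).card = 2 := by rw [card_erase_of_mem xA, cA]
  have hne : (A.erase x).Nonempty := by rw [← card_pos]; omega
  obtain ⟨y, hy⟩ := hne
  have hyU : y ∈ A.erase x ∪ B.erase x ∪ C.erase x := mem_union_left _ (mem_union_left _ hy)
  rw [hUe] at hyU
  simp at hyU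

/-- (iii) No three pairwise disjoint 3-representations of `τ` (their union would be a zero-sum set). -/
theorem soloBlind_rep3_three_disjoint (zsf : ∀ T ⊆ S, ∑ x ∈ T, x = 0 → T = ∅)
    (h3 : ∀ y : G, y + y + y = 0) {A B C : Finset G}
    (hA : A ∈ soloBlindRep3 S τ) (hB : B ∈ soloBlindRep3 S τ) (hC : C ∈ soloBlindRep3 S τ)
    (dAB : Disjoint A B) (dAC : Disjoint A C) (dBC : Disjoint B C) : False := by
  rw [soloBlind_mem_rep3] at hA hB hC
  obtain ⟨sA, cA, eA⟩ := hA
  obtain ⟨sB, -, eB⟩ := hB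
  obtain ⟨sC, -, eC⟩ := hC
  have hUS : A ∪ B ∪ C ⊆ S := union_subset (union_subset sA sB) sC
  have hsum : ∑ y ∈ A ∪ B ∪ C, y = 0 := by
    rw [sum_union (disjoint_union_left.mpr ⟨dAC, dBC⟩), sum_union dAB, eA, eB, eC]
    exact h3 τ
  have hUe := zsf _ hUS hsum
  have hne : A.Nonempty := by rw [← card_pos]; omega
  obtain ⟨y, hy⟩ := hne
  have hyU : y ∈ A ∪ B ∪ C := mem_union_left _ (mem_union_left _ hy)
  rw [hUe] at hyU
  simp at hyU

/-- (iv) No four pairwise meeting 3-representations of `τ`: they would form a Pasch configuration,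
which forces two of its six points to coincide. -/
theorem soloBlind_rep3_no_four_meeting (zsf : ∀ T ⊆ S, ∑ x ∈ T, x = 0 → T = ∅)
    (h3 : ∀ y : G, y + y + y = 0) {A B C D : Finset G}
    (hA : A ∈ soloBlindRep3 S τ) (hB : B ∈ soloBlindRep3 S τ) (hC : C ∈ soloBlindRep3 S τ)
    (hD : D ∈ soloBlindRep3 S τ)
    (hAB : A ≠ B) (hAC : A ≠ C) (hAD : A ≠ D) (hBC : B ≠ C) (hBD : B ≠ D) (hCD : C ≠ D)
    (mAB : (A ∩ B).Nonempty) (mAC : (A ∩ C).Nonempty) (mAD : (A ∩ D).Nonempty)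
    (mBC : (B ∩ C).Nonempty) (mBD : (B ∩ D).Nonempty) (mCD : (C ∩ D).Nonempty) : False := by
  -- each pair meets in exactly one point
  have pt : ∀ {P Q : Finset G}, P ∈ soloBlindRep3 S τ → Q ∈ soloBlindRep3 S τ → P ≠ Q →
      (P ∩ Q).Nonempty → ∃ p, P ∩ Q = {p} := by
    intro P Q hP hQ hPQ hm
    apply card_eq_one.mp
    have := soloBlind_rep3_inter_card_le_one hP hQ hPQ
    have := hm.card_pos
    omega
  have mem2 : ∀ {P Q : Finset G} {p : G}, P ∩ Q = {p} → p ∈ P ∧ p ∈ Q := by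
    intro P Q p h
    have : p ∈ P ∩ Q := by rw [h]; exact mem_singleton_self p
    exact mem_inter.mp this
  obtain ⟨ab, hab⟩ := pt hA hB hAB mAB
  obtain ⟨ac, hac⟩ := pt hA hC hAC mAC
  obtain ⟨ad, had⟩ := pt hA hD hAD mAD
  obtain ⟨bc, hbc⟩ := pt hB hC hBC mBC
  obtain ⟨bd, hbd⟩ := pt hB hD hBD mBD
  obtain ⟨cd, hcd⟩ := pt hC hD hCD mCD
  obtain ⟨abA, abB⟩ := mem2 hab
  obtain ⟨acA, acC⟩ := mem2 hac
  obtain ⟨adA, adD⟩ := mem2 had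
  obtain ⟨bcB, bcC⟩ := mem2 hbc
  obtain ⟨bdB, bdD⟩ := mem2 hbd
  obtain ⟨cdC, cdD⟩ := mem2 hcd
  have T := @soloBlind_rep3_three_point G _ _ S τ zsf h3
  -- the six points are pairwise distinct where needed (else a point of degree 3)
  have n1 : ab ≠ ac := fun h => by subst h; exact T hA hB hC hAB hAC hBC abA abB acC
  have n2 : ab ≠ ad := fun h => by subst h; exact T hA hB hD hAB hAD hBD abA abB adD
  have n3 : ac ≠ ad := fun h => by subst h; exact T hA hC hD hAC hAD hCD acA acC adD
  have n4 : ab ≠ bc := fun h => by subst h; exact T hA hB hC hAB hAC hBC abA abB bcC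
  have n5 : ab ≠ bd := fun h => by subst h; exact T hA hB hD hAB hAD hBD abA abB bdD
  have n6 : bc ≠ bd := fun h => by subst h; exact T hB hC hD hBC hBD hCD bcB bcC bdD
  have n7 : ac ≠ bc := fun h => by subst h; exact T hA hB hC hAB hAC hBC acA bcB acC
  have n8 : ac ≠ cd := fun h => by subst h; exact T hA hC hD hAC hAD hCD acA acC cdD
  have n9 : bc ≠ cd := fun h => by subst h; exact T hB hC hD hBC hBD hCD bcB bcC cdD
  have n10 : ad ≠ bd := fun h => by subst h; exact T hA hB hD hAB hAD hBD adA bdB adD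
  have n11 : ad ≠ cd := fun h => by subst h; exact T hA hC hD hAC hAD hCD adA cdC adD
  have n12 : bd ≠ cd := fun h => by subst h; exact T hB hC hD hBC hBD hCD bdB cdC bdD
  -- a member is the set of its three meeting points, so its sum is their sum
  have shape : ∀ {P : Finset G} {p q r : G}, P ∈ soloBlindRep3 S τ → p ∈ P → q ∈ P → r ∈ P →
      p ≠ q → p ≠ r → q ≠ r → p + (q + r) = τ := by
    intro P p q r hP pP qP rP hpq hpr hqr
    rw [soloBlind_mem_rep3] at hP
    have hsub : ({p, q, r} : Finset G) ⊆ P := by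
      intro y hy
      simp only [mem_insert, mem_singleton] at hy
      rcases hy with rfl | rfl | rfl <;> assumption
    have hcard : ({p, q, r} : Finset G).card = 3 := card_eq_three.mpr ⟨p, q, r, hpq, hpr, hqr, rfl⟩
    have hPe : ({p, q, r} : Finset G) = P :=
      eq_of_subset_of_card_le hsub (by rw [hcard, hP.2.1])
    rw [← hP.2.2, ← hPe, sum_insert (by simp [hpq, hpr]), sum_insert (by simp [hqr]), sum_singleton]
  have eA : ab + (ac + ad) = τ := shape hA abA acA adA n1 n2 n3
  have eB : ab + (bc + bd) = τ := shape hB abB bcB bdB n4 n5 n6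
  have eC : ac + (bc + cd) = τ := shape hC acC bcC cdC n7 n8 n9
  have eD : ad + (bd + cd) = τ := shape hD adD bdD cdD n10 n11 n12
  have key : (ab + ab) - (cd + cd) =
      (ab + (ac + ad) - τ) + (ab + (bc + bd) - τ) - (ac + (bc + cd) - τ) - (ad + (bd + cd) - τ) := by
    abel
  rw [eA, eB, eC, eD, sub_self, add_zero, sub_zero, sub_zero, sub_eq_zero] at key
  have habcd : ab = cd :=
    calc ab = -(ab + ab) := by rw [eq_neg_iff_add_eq_zero, ← add_assoc]; exact h3 ab
      _ = -(cd + cd) := by rw [key]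
      _ = cd := neg_eq_iff_add_eq_zero.mpr (h3 cd)
  have abC : ab ∈ C := by rw [habcd]; exact cdC
  exact T hA hB hC hAB hAC hBC abA abB abC

/-- MAIN THEOREM (squarefree `L(3)`, all ranks): a zero-sum-free subset of an abelian group of exponent 3
has at most six 3-element subsets with any given sum. -/
theorem soloBlind_rep3_card_le_six (zsf : ∀ T ⊆ S, ∑ x ∈ T, x = 0 → T = ∅)
    (h3 : ∀ y : G, y + y + y = 0) : (soloBlindRep3 S τ).card ≤ 6 := by
  set F := soloBlindRep3 S τ with hF
  by_contra hlt
  rw [not_le] at hlt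
  -- a member meets at most three others (at most one through each of its points)
  have hM : ∀ A ∈ F, ((F.erase A).filter (fun B => (A ∩ B).Nonempty)).card ≤ 3 := by
    intro A hA
    have cA : A.card = 3 := (soloBlind_mem_rep3.mp hA).2.1
    calc ((F.erase A).filter (fun B => (A ∩ B).Nonempty)).card
        ≤ (A.biUnion (fun x => (F.erase A).filter (fun B => x ∈ B))).card := by
          apply card_le_card
          intro B hB
          rw [mem_filter] at hB
          obtain ⟨x, hx⟩ := hB.2
          rw [mem_biUnion]
          exact ⟨x, (mem_inter.mp hx).1, mem_filter.mpr ⟨hB.1, (mem_inter.mp hx).2⟩⟩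
      _ ≤ ∑ x ∈ A, ((F.erase A).filter (fun B => x ∈ B)).card := card_biUnion_le
      _ ≤ ∑ x ∈ A, 1 := by
          apply sum_le_sum
          intro x hx
          apply card_le_one.mpr
          intro B hB B' hB'
          rw [mem_filter, mem_erase] at hB hB'
          by_contra hne
          exact soloBlind_rep3_three_point zsf h3 hA hB.1.2 hB'.1.2 (Ne.symm hB.1.1)
            (Ne.symm hB'.1.1) hne hx hB.2 hB'.2
      _ = 3 := by simp [cA]
  -- a member misses at most three others (those meet pairwise; four would be a Pasch configuration)
  have hD : ∀ A ∈ F, ((F.erase A).filter (fun B => ¬ (A ∩ B).Nonempty)).card ≤ 3 := by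
    intro A hA
    by_contra h4
    rw [not_le] at h4
    have memD : ∀ {B : Finset G}, B ∈ (F.erase A).filter (fun B => ¬ (A ∩ B).Nonempty) →
        B ∈ F ∧ B ≠ A ∧ Disjoint A B := by
      intro B hB
      rw [mem_filter, mem_erase, not_nonempty_iff_eq_empty, ← disjoint_iff_inter_eq_empty] at hB
      exact ⟨hB.1.2, hB.1.1, hB.2⟩
    have meet : ∀ {B C : Finset G}, B ∈ (F.erase A).filter (fun B => ¬ (A ∩ B).Nonempty) →
        C ∈ (F.erase A).filter (fun B => ¬ (A ∩ B).Nonempty) → B ≠ C → (B ∩ C).Nonempty := by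
      intro B C hB hC _
      rw [nonempty_iff_ne_empty]
      intro he
      exact soloBlind_rep3_three_disjoint zsf h3 hA (memD hB).1 (memD hC).1 (memD hB).2.2
        (memD hC).2.2 (disjoint_iff_inter_eq_empty.mpr he)
    obtain ⟨B₁, hB₁⟩ : ((F.erase A).filter (fun B => ¬ (A ∩ B).Nonempty)).Nonempty := by
      rw [← card_pos]; omega
    have h3lt : 2 < (((F.erase A).filter (fun B => ¬ (A ∩ B).Nonempty)).erase B₁).card := by
      rw [card_erase_of_mem hB₁]; omega
    obtain ⟨B₂, hB₂, B₃, hB₃, B₄, hB₄, h23, h24, h34⟩ := two_lt_card.mp h3lt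
    rw [mem_erase] at hB₂ hB₃ hB₄
    exact soloBlind_rep3_no_four_meeting zsf h3 (memD hB₁).1 (memD hB₂.2).1 (memD hB₃.2).1
      (memD hB₄.2).1 (Ne.symm hB₂.1) (Ne.symm hB₃.1) (Ne.symm hB₄.1) h23 h24 h34
      (meet hB₁ hB₂.2 (Ne.symm hB₂.1)) (meet hB₁ hB₃.2 (Ne.symm hB₃.1))
      (meet hB₁ hB₄.2 (Ne.symm hB₄.1)) (meet hB₂.2 hB₃.2 h23) (meet hB₂.2 hB₄.2 h24)
      (meet hB₃.2 hB₄.2 h34)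
  have split : ∀ A ∈ F, F.card - 1 = ((F.erase A).filter (fun B => (A ∩ B).Nonempty)).card +
      ((F.erase A).filter (fun B => ¬ (A ∩ B).Nonempty)).card := by
    intro A hA
    rw [card_filter_add_card_filter_not, card_erase_of_mem hA]
  -- hence `|F| = 7` and every member meets exactly three others ...
  have h7 : F.card = 7 := by
    obtain ⟨A₀, hA₀⟩ : F.Nonempty := by rw [← card_pos]; omega
    have := split A₀ hA₀; have := hM A₀ hA₀; have := hD A₀ hA₀; omega
  have hM3 : ∀ A ∈ F, ((F.erase A).filter (fun B => (A ∩ B).Nonempty)).card = 3 := by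
    intro A hA
    have := split A hA; have := hM A hA; have := hD A hA; omega
  -- ... so there are 21 ordered meeting pairs, an odd number, although swapping is a fixed-point-free
  -- involution on them
  have cR : (F.sigma (fun A => (F.erase A).filter (fun B => (A ∩ B).Nonempty))).card = 21 := by
    rw [card_sigma, sum_congr rfl hM3]
    simp [h7]
  have par : ∑ p ∈ F.sigma (fun A => (F.erase A).filter (fun B => (A ∩ B).Nonempty)),
      (1 : ZMod 2) = 0 := by
    refine sum_involution (fun p _ => ⟨p.2, p.1⟩) ?_ ?_ ?_ ?_
    · intro p _; decide
    · intro p hp _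
      simp only [mem_sigma, mem_filter, mem_erase] at hp
      intro he
      exact hp.2.1.1 (congrArg Sigma.fst he)
    · intro p hp
      simp only [mem_sigma, mem_filter, mem_erase] at hp ⊢
      exact ⟨hp.2.1.2, ⟨Ne.symm hp.2.1.1, hp.1⟩, by rw [inter_comm]; exact hp.2.2⟩
    · intro p _; rfl
  rw [sum_const, cR] at par
  exact absurd par (by decide)

/-- The `ZMod 3`-module form (vector spaces over `𝔽₃` of any rank). -/
theorem soloBlind_rep3_card_le_six_module {V : Type*} [AddCommGroup V] [Module (ZMod 3) V]
    [DecidableEq V] {S : Finset V} (zsf : ∀ T ⊆ S, ∑ x ∈ T, x = 0 → T = ∅) (τ : V) :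
    (soloBlindRep3 S τ).card ≤ 6 :=
  soloBlind_rep3_card_le_six zsf (fun y => soloBlind_three_torsion y)

end Main

/-! ### Sharpness: six is attained (a zero-sum-free 10-set in `𝔽₃⁵`) -/

/-- `𝔽₃⁵` as a nested product (computation-friendly). -/
abbrev SoloBlindL3G5 : Type := ZMod 3 × ZMod 3 × ZMod 3 × ZMod 3 × ZMod 3

/-- The ten values (found by search; the universal realisation of the closed 3-class
`{1,2,3},{1,7,8},{2,4,9},{3,7,10},{4,5,6},{5,8,9}` of the seat's `k = 3` census, here 0-indexed). -/
def soloBlindL3_h : Fin 10 → SoloBlindL3G5 :=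
  ![(1, 2, 0, 2, 2), (2, 1, 1, 0, 2), (2, 1, 1, 1, 1), (1, 1, 2, 0, 1), (0, 0, 0, 0, 2),
    (1, 0, 0, 0, 2), (1, 0, 2, 1, 2), (0, 2, 0, 0, 1), (2, 2, 2, 0, 2), (2, 0, 2, 1, 2)]

/-- The target `τ = (2,1,2,0,2)`. -/
def soloBlindL3_tau : SoloBlindL3G5 := (2, 1, 2, 0, 2)

/-- The values are pairwise distinct (it is a SET). -/
theorem soloBlindL3_injective : Function.Injective soloBlindL3_h := by
  decide

/-- The set is zero-sum free (all `2^10` index subsets). -/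
theorem soloBlindL3_zsf : ∀ T : Finset (Fin 10), ∑ i ∈ T, soloBlindL3_h i = 0 → T = ∅ := by
  decide +kernel

/-- Exactly six 3-subsets of indices have sum `τ`. -/
theorem soloBlindL3_six : ((univ : Finset (Fin 10)).powersetCard 3).filter
    (fun T => ∑ i ∈ T, soloBlindL3_h i = soloBlindL3_tau) =
    {{0, 1, 2}, {0, 6, 7}, {1, 3, 8}, {2, 6, 9}, {3, 4, 5}, {4, 7, 8}} := by
  decide +kernel

/-- Transfer from an injective enumeration to the value set. -/
theorem soloBlind_rep3_card_map {ι : Type*} [Fintype ι] [DecidableEq ι] (e : ι → G)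
    (he : Function.Injective e) (τ : G) :
    (soloBlindRep3 ((univ : Finset ι).map ⟨e, he⟩) τ).card =
    (((univ : Finset ι).powersetCard 3).filter (fun T => ∑ i ∈ T, e i = τ)).card := by
  unfold soloBlindRep3
  rw [powersetCard_map, filter_map, card_map]
  congr 1
  apply filter_congr
  intro T _
  simp [Function.comp, sum_map]

/-- SHARPNESS: the zero-sum-free 10-set `soloBlindL3_h` has exactly six 3-subsets of sum `τ`. -/
theorem soloBlind_rep3_six_attained :
    (∀ T ⊆ (univ : Finset (Fin 10)).map ⟨soloBlindL3_h, soloBlindL3_injective⟩,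
      ∑ x ∈ T, x = 0 → T = ∅) ∧
    (soloBlindRep3 ((univ : Finset (Fin 10)).map ⟨soloBlindL3_h, soloBlindL3_injective⟩)
      soloBlindL3_tau).card = 6 := by
  refine ⟨?_, ?_⟩
  · intro T hT hsum
    -- pull `T` back to an index set
    obtain ⟨U, rfl⟩ : ∃ U : Finset (Fin 10), U.map ⟨soloBlindL3_h, soloBlindL3_injective⟩ = T := by
      refine ⟨univ.filter (fun i => soloBlindL3_h i ∈ T), ?_⟩
      ext x
      simp only [mem_map, mem_filter, mem_univ, true_and, Function.Embedding.coeFn_mk]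
      constructor
      · rintro ⟨i, hi, rfl⟩; exact hi
      · intro hx
        have := hT hx
        rw [mem_map] at this
        obtain ⟨i, -, rfl⟩ := this
        exact ⟨i, hx, rfl⟩
    rw [sum_map] at hsum
    have := soloBlindL3_zsf U hsum
    rw [this]; rfl
  · rw [soloBlind_rep3_card_map soloBlindL3_h soloBlindL3_injective, soloBlindL3_six]
    decide

end Summit.MatrixMultiplication.MatrixMultiplication.Theorems
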